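import Mathlib.Analysis.SpecialFunctions.Pow.Real
import Mathlib.Analysis.SpecialFunctions.Pow.Continuity
import Mathlib.Analysis.SpecificLimits.Normed
import HarnessLib

/-!
# The extraction lemma with a weight factor `θ`: from a finite insertion core to a margin between growth rates

Topic `Literature/Probability/RandomPlanarGeometry` (continues `HexSAWBrickWallStripMargin.lean`, whose
`MarginExtraction.log_margin_of_core` is the case `θ = 1`).  This file is LATTICE-FREE: it turns a finite
"insertion core" inequality

  `αⁿ xⁿ (1 + θ x^E)^{⌊n/(L+1)⌋} ≤ B · Σ_{m ≤ K n} C_m x^m`   (all `n`, all `0 < x ≤ 1`),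

where `0 ≤ θ`, `C_m ≥ 0` and `C_m^{1/m} → γ ≥ 1`, into the margin `log(1 + θ γ^{-E})/(L+1) ≤ log γ − log α`.
It is the analytic half of the lane's proofs of the strict strip / slab inequalities WITH A SURFACE FUGACITY
(the factor `θ = min(1, y^k)` is the worst-case change of the surface weight under one insertion): Madras–Slade,
*The Self-Avoiding Walk* (1993), §8.2, Theorem 8.2.1, (8.2.13) p. 269 ("`μ(R[k,T]) < μ(R[k,T+1])`", printed for
`ℤ^d` at `y = 1` via Kesten's pattern theorem — the quantitative core-to-margin route is the lane's, not the
printed proof); served statements: BBdGDCG 2014 Proposition 7 and Beaton 2014 Proposition 9 (strict parts, every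
`y > 0`) in the files that import this one.  No lattice object is mentioned here.

## Statement (namespace `Literature.Probability.RandomPlanarGeometry.SAW.MarginExtraction`, PROVED, standard axioms)

* **`log_margin_of_core_theta`** — the displayed implication (proof: for `0 < x < 1/γ` the terms `C_m x^m` are
  bounded, so `g(x) := α x (1 + θ x^E)^{1/(L+1)}` satisfies `g(x)ⁿ ≤ D·n`, hence `g(x) ≤ 1`; continuity at
  `x = 1/γ`; logarithms).
-/

noncomputable section

open Filter Topology Finset

namespace Literature.Probability.RandomPlanarGeometry.SAW

namespace MarginExtraction

/-- For `0 < x < 1/γ` and `C_m^{1/m} → γ`, the sequence `C_m x^m` is bounded. [folklore] -/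
private theorem exists_bound_of_tendsto_rpow' {C : ℕ → ℝ} {γ x : ℝ} (hC0 : ∀ m, 0 ≤ C m)
    (hC : Tendsto (fun m : ℕ => C m ^ (1 / (m : ℝ))) atTop (𝓝 γ)) (hγ : 0 < γ) (hx : 0 < x)
    (hxγ : x < 1 / γ) : ∃ K : ℝ, 0 ≤ K ∧ ∀ m, C m * x ^ m ≤ K := by
  set u : ℝ := (γ + x⁻¹) / 2 with hu
  have hxinv : γ < x⁻¹ := by
    have := (lt_one_div hx hγ).1 hxγ; rwa [one_div] at this
  have hγu : γ < u := by rw [hu]; linarith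
  have hux : u * x ≤ 1 := by
    have : u < x⁻¹ := by rw [hu]; linarith
    have h1 : u * x < x⁻¹ * x := mul_lt_mul_of_pos_right this hx
    rw [inv_mul_cancel₀ hx.ne'] at h1
    exact h1.le
  have hu0 : 0 ≤ u := by rw [hu]; positivity
  have hev : ∀ᶠ m : ℕ in atTop, C m * x ^ m ≤ 1 := by
    filter_upwards [hC.eventually_lt_const hγu, eventually_ge_atTop 1] with m hm hm1
    have hm0 : (m : ℕ) ≠ 0 := by omega
    have h1 : C m = (C m ^ (1 / (m : ℝ))) ^ m := by
      rw [one_div, Real.rpow_inv_natCast_pow (hC0 m) hm0]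
    have h2 : C m ≤ u ^ m := by
      rw [h1]; exact pow_le_pow_left₀ (Real.rpow_nonneg (hC0 m) _) hm.le m
    calc C m * x ^ m ≤ u ^ m * x ^ m := mul_le_mul_of_nonneg_right h2 (pow_nonneg hx.le m)
      _ = (u * x) ^ m := (mul_pow u x m).symm
      _ ≤ 1 := pow_le_one₀ (mul_nonneg hu0 hx.le) hux
  obtain ⟨N, hN⟩ := eventually_atTop.1 hev
  refine ⟨1 + ∑ m ∈ Finset.range N, C m * x ^ m, ?_, fun m => ?_⟩
  · have : 0 ≤ ∑ m ∈ Finset.range N, C m * x ^ m :=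
      Finset.sum_nonneg fun m _ => mul_nonneg (hC0 m) (pow_nonneg hx.le m)
    linarith
  · rcases lt_or_ge m N with h | h
    · have : C m * x ^ m ≤ ∑ m ∈ Finset.range N, C m * x ^ m :=
        Finset.single_le_sum (f := fun m => C m * x ^ m)
          (fun m _ => mul_nonneg (hC0 m) (pow_nonneg hx.le m)) (Finset.mem_range.2 h)
      linarith
    · have : 0 ≤ ∑ m ∈ Finset.range N, C m * x ^ m :=
        Finset.sum_nonneg fun m _ => mul_nonneg (hC0 m) (pow_nonneg hx.le m)
      linarith [hN m h]

/-- Exponential versus linear growth: if `yⁿ ≤ D·n` for all `n ≥ 1` then `y ≤ 1`. [folklore] -/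
private theorem le_one_of_pow_le_mul' {y D : ℝ} (hD : 0 ≤ D) (h : ∀ n : ℕ, 1 ≤ n → y ^ n ≤ D * n) :
    y ≤ 1 := by
  by_contra hy1
  rw [not_le] at hy1
  have ht := tendsto_pow_const_div_const_pow_of_one_lt 1 hy1
  have hev := ht.eventually_lt_const (show (0 : ℝ) < 1 / (D + 1) by positivity)
  obtain ⟨N, hN⟩ := eventually_atTop.1 hev
  have hN1 := hN (N + 1) (by omega)
  have hn := h (N + 1) (by omega)
  have hpow : 0 < y ^ (N + 1) := pow_pos (by linarith) _
  simp only [pow_one] at hN1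
  have h1 : 1 ≤ D * (((N + 1 : ℕ) : ℝ) / y ^ (N + 1)) := by
    rw [mul_div_assoc', le_div_iff₀ hpow, one_mul]; exact hn
  have h2 : D * (((N + 1 : ℕ) : ℝ) / y ^ (N + 1)) ≤ D * (1 / (D + 1)) :=
    mul_le_mul_of_nonneg_left hN1.le hD
  have h3 : D * (1 / (D + 1)) < 1 := by
    rw [mul_one_div, div_lt_one (by linarith)]; linarith
  linarith

/-- `n/(L+1) ≤ ⌊n/(L+1)⌋ + 1` between real and natural division. [folklore] -/
private theorem div_le_natDiv_add_one' (n L : ℕ) : (n : ℝ) / ((L : ℝ) + 1) ≤ ((n / (L + 1) : ℕ) : ℝ) + 1 := by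
  have h := Nat.lt_div_mul_add (a := n) (b := L + 1) (by omega)
  rw [div_le_iff₀ (by positivity)]
  have : (n : ℝ) ≤ ((n / (L + 1) : ℕ) : ℝ) * ((L : ℝ) + 1) + ((L : ℝ) + 1) := by
    exact_mod_cast h.le
  linarith

/-- **Extraction lemma with a weight factor `θ`**: if `αⁿ xⁿ (1 + θ x^E)^{⌊n/(L+1)⌋} ≤ B Σ_{m ≤ Kn} C_m x^m` for all
`n` and all `0 < x ≤ 1`, where `0 ≤ θ` and `C_m^{1/m} → γ ≥ 1`, then `log(1 + θ γ^{-E})/(L+1) ≤ log γ − log α`.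
(The case `θ = 1` is `log_margin_of_core`; the proof is the same.)
[cite: MadrasSlade1993, §8.2, Theorem 8.2.1 (8.2.13), p. 269 (quantitative forms: the lane's column insertion)] -/
theorem log_margin_of_core_theta {α γ B θ : ℝ} {E L K : ℕ} {C : ℕ → ℝ} (hα : 0 < α) (hγ : 1 ≤ γ) (hB : 0 ≤ B)
    (hθ0 : 0 ≤ θ)
    (hC0 : ∀ m, 0 ≤ C m) (hC : Tendsto (fun m : ℕ => C m ^ (1 / (m : ℝ))) atTop (𝓝 γ))
    (h : ∀ n : ℕ, ∀ x : ℝ, 0 < x → x ≤ 1 →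
      α ^ n * x ^ n * (1 + θ * x ^ E) ^ (n / (L + 1)) ≤
        B * ∑ m ∈ Finset.range (K * n + 1), C m * x ^ m) :
    Real.log (1 + θ * γ ^ (-(E : ℝ))) / ((L : ℝ) + 1) ≤ Real.log γ - Real.log α := by
  have hγ0 : 0 < γ := by linarith
  set r : ℝ := 1 / ((L : ℝ) + 1) with hr
  have hr0 : 0 ≤ r := by rw [hr]; positivity
  set g : ℝ → ℝ := fun x => α * x * (1 + θ * x ^ E) ^ r with hg
  -- Step B: `g x ≤ 1` for `0 ≤ x < 1/γ`
  have hB' : ∀ x : ℝ, 0 ≤ x → x < 1 / γ → g x ≤ 1 := by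
    intro x hx0 hxγ
    rcases hx0.eq_or_lt with rfl | hx
    · simp [hg]
    have hx1 : x ≤ 1 := by
      have : 1 / γ ≤ 1 := by rw [div_le_one hγ0]; exact hγ
      linarith
    obtain ⟨Kx, hKx0, hKx⟩ := exists_bound_of_tendsto_rpow' hC0 hC hγ0 hx hxγ
    have hθx : 0 ≤ θ * x ^ E := mul_nonneg hθ0 (pow_nonneg hx.le E)
    have hb1 : 1 ≤ 1 + θ * x ^ E := by linarith
    have hgx : g x = α * x * (1 + θ * x ^ E) ^ r := rfl
    refine le_one_of_pow_le_mul'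
      (show 0 ≤ (1 + θ * x ^ E) * B * Kx * ((K : ℝ) + 1) by positivity) fun n hn => ?_
    have e1 : g x ^ n = α ^ n * x ^ n * (1 + θ * x ^ E) ^ (r * n) := by
      rw [hgx, mul_pow, mul_pow, Real.rpow_mul (by linarith), Real.rpow_natCast]
    have e2 : (1 + θ * x ^ E) ^ (r * n) ≤ (1 + θ * x ^ E) ^ (n / (L + 1)) * (1 + θ * x ^ E) := by
      rw [← Real.rpow_natCast (1 + θ * x ^ E) (n / (L + 1)), ← Real.rpow_add_one (by linarith)]
      refine Real.rpow_le_rpow_of_exponent_le hb1 ?_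
      rw [hr, one_div_mul_eq_div]
      exact div_le_natDiv_add_one' n L
    have e3 : ∑ m ∈ Finset.range (K * n + 1), C m * x ^ m ≤ ((K * n + 1 : ℕ) : ℝ) * Kx := by
      calc ∑ m ∈ Finset.range (K * n + 1), C m * x ^ m ≤ ∑ _m ∈ Finset.range (K * n + 1), Kx :=
            Finset.sum_le_sum fun m _ => hKx m
        _ = _ := by rw [Finset.sum_const, Finset.card_range, nsmul_eq_mul]
    have e4 : ((K * n + 1 : ℕ) : ℝ) ≤ ((K : ℝ) + 1) * n := by
      push_cast
      have : (1 : ℝ) ≤ n := by exact_mod_cast hn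
      nlinarith
    have hmain := h n x hx hx1
    calc g x ^ n = α ^ n * x ^ n * (1 + θ * x ^ E) ^ (r * n) := e1
      _ ≤ α ^ n * x ^ n * ((1 + θ * x ^ E) ^ (n / (L + 1)) * (1 + θ * x ^ E)) :=
          mul_le_mul_of_nonneg_left e2 (by positivity)
      _ = (α ^ n * x ^ n * (1 + θ * x ^ E) ^ (n / (L + 1))) * (1 + θ * x ^ E) := by ring
      _ ≤ (B * ∑ m ∈ Finset.range (K * n + 1), C m * x ^ m) * (1 + θ * x ^ E) :=
          mul_le_mul_of_nonneg_right hmain (by linarith)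
      _ ≤ (B * (((K * n + 1 : ℕ) : ℝ) * Kx)) * (1 + θ * x ^ E) :=
          mul_le_mul_of_nonneg_right (mul_le_mul_of_nonneg_left e3 hB) (by linarith)
      _ ≤ (B * ((((K : ℝ) + 1) * n) * Kx)) * (1 + θ * x ^ E) :=
          mul_le_mul_of_nonneg_right (mul_le_mul_of_nonneg_left
            (mul_le_mul_of_nonneg_right e4 hKx0) hB) (by linarith)
      _ = (1 + θ * x ^ E) * B * Kx * ((K : ℝ) + 1) * n := by ring
  -- Step C: continuity at `x₀ = 1/γ`
  have hcont : Continuous g := by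
    rw [hg]
    exact (continuous_const.mul continuous_id).mul
      ((continuous_const.add (continuous_const.mul (continuous_pow E))).rpow_const fun x => Or.inr hr0)
  set xs : ℕ → ℝ := fun k => (1 / γ) * (1 - 1 / ((k : ℝ) + 1)) with hxs
  have hxs_lim : Tendsto xs atTop (𝓝 (1 / γ)) := by
    have h1 : Tendsto (fun k : ℕ => (1 : ℝ) - 1 / ((k : ℝ) + 1)) atTop (𝓝 (1 - 0)) :=
      tendsto_const_nhds.sub tendsto_one_div_add_atTop_nhds_zero_nat
    have h2 := h1.const_mul (1 / γ)
    rw [sub_zero, mul_one] at h2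
    exact h2
  have hgx0 : g (1 / γ) ≤ 1 := by
    refine le_of_tendsto' ((hcont.tendsto _).comp hxs_lim) fun k => hB' (xs k) ?_ ?_
    · rw [hxs]
      have : (0 : ℝ) ≤ 1 - 1 / ((k : ℝ) + 1) := by
        rw [sub_nonneg, div_le_one (by positivity)]; linarith
      positivity
    · rw [hxs]
      have h1 : (0 : ℝ) < 1 / ((k : ℝ) + 1) := by positivity
      have h2 : 0 < 1 / γ := by positivity
      nlinarith
  -- Step D: logarithms
  have hb : 0 < 1 + θ * γ ^ (-(E : ℝ)) := by positivity
  have hval : g (1 / γ) = α * γ⁻¹ * (1 + θ * γ ^ (-(E : ℝ))) ^ r := by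
    rw [hg]; simp only
    rw [one_div, Real.rpow_neg hγ0.le, Real.rpow_natCast, inv_pow]
  rw [hval] at hgx0
  have hpos : 0 < α * γ⁻¹ * (1 + θ * γ ^ (-(E : ℝ))) ^ r := by positivity
  have hlog := Real.log_nonpos hpos.le hgx0
  rw [Real.log_mul (by positivity) (by positivity), Real.log_mul hα.ne' (by positivity),
    Real.log_inv, Real.log_rpow hb, hr, one_div_mul_eq_div] at hlog
  linarith

end MarginExtraction

end Literature.Probability.RandomPlanarGeometry.SAW
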